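import Summits.Ventures.HodgeRepro.BallDominance

/-!
# The image of the ball lies in no proper common zero locus of entire functions (seat p5)

Blind re-derivation cell `pub-hodge-repro`, seat `p5`.  The «no proper closed subvariety» reading of
`BallDominance.lean` made explicit: a closed subvariety `Z ⊊ A′` of the projective abelian variety `A′ = ℂ^g/Λ` pulls
back to `ℂ^g` as the COMMON zero locus of a family of theta functions (the homogeneous generators of the ideal of
`Z`, restricted to `A′` and lifted to `ℂ^g` — entire, `Λ`-quasi-periodic functions).  If the image of the ball under
an analytic `f̃` of rank `g` at one point lies in such a common zero locus, every function of the family vanishes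
identically (`BallDominance`), so the locus is all of `ℂ^g` — i.e. `Z = A′`.  Hence `f(S′)` lies in no proper closed
subvariety of `A′`: `f` is dominant.  What stays on paper is only that closed subvarieties of `A′` pull back to
common zero loci of theta functions (the projective embedding; Lefschetz / Appell–Humbert).

* `zeroLocus_eq_univ_of_image_subset_of_mem_nhds` — `f '' U ∈ 𝓝 w₀`, every `H i` entire, `f '' U ⊆ ⋂ᵢ {H i = 0}`
  ⇒ `⋂ᵢ {H i = 0} = univ`;
* `zeroLocus_eq_univ_of_image_subset_of_linearIndependent_dcov` — the rank form (`h₁, …, h_g` analytic at `z` with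
  independent differential covectors, `U ∈ 𝓝 z`);
* `not_image_subset_zeroLocus_of_linearIndependent_dcov` — the contrapositive: a common zero locus that is not all
  of `ℂ^g` does not contain the image.

Nothing here says anything about the status of the Hodge conjecture for CM abelian varieties.
-/

set_option autoImplicit false

noncomputable section

namespace HodgeRepro.BallGen

namespace Dom

open Filter Topology Subm

variable {g : ℕ}

/-- **A common zero locus of entire functions containing a set with non-empty interior is everything.**  If
`f '' U` is a neighbourhood of some point, every `H i` is entire and `f '' U ⊆ ⋂ᵢ {w | H i w = 0}`, then
`⋂ᵢ {w | H i w = 0} = univ`. -/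
theorem zeroLocus_eq_univ_of_image_subset_of_mem_nhds {p : ℕ} {f : (Fin p → ℂ) → (Fin g → ℂ)}
    {U : Set (Fin p → ℂ)} {w₀ : Fin g → ℂ} (hU : f '' U ∈ 𝓝 w₀) {ι : Type} {H : ι → (Fin g → ℂ) → ℂ}
    (hH : ∀ i, AnalyticOnNhd ℂ (H i) Set.univ) (hsub : f '' U ⊆ {w | ∀ i, H i w = 0}) :
    {w | ∀ i, H i w = 0} = Set.univ := by
  refine Set.eq_univ_of_forall fun w i => ?_
  have h0 : H i = 0 :=
    eq_zero_of_eqOn_image_of_mem_nhds hU (hH i) fun u hu => hsub ⟨u, hu, rfl⟩ i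
  exact congrFun h0 w

/-- **Rank `g` at one point ⇒ the image of a neighbourhood lies in no proper common zero locus.**  If
`h₁, …, h_g` are analytic at `z` with independent differential covectors, `U ∈ 𝓝 z`, every `H i` is entire and
`(h₁, …, h_g)(U) ⊆ ⋂ᵢ {H i = 0}`, then `⋂ᵢ {H i = 0} = univ`. -/
theorem zeroLocus_eq_univ_of_image_subset_of_linearIndependent_dcov {p : ℕ}
    (h : Fin g → (Fin p → ℂ) → ℂ) {z : Fin p → ℂ} (ha : ∀ l, AnalyticAt ℂ (h l) z)
    (hli : LinearIndependent ℂ fun l => dcov (h l) z) {U : Set (Fin p → ℂ)} (hU : U ∈ 𝓝 z)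
    {ι : Type} {H : ι → (Fin g → ℂ) → ℂ} (hH : ∀ i, AnalyticOnNhd ℂ (H i) Set.univ)
    (hsub : (fun w l => h l w) '' U ⊆ {w | ∀ i, H i w = 0}) : {w | ∀ i, H i w = 0} = Set.univ :=
  zeroLocus_eq_univ_of_image_subset_of_mem_nhds (image_mem_nhds_of_linearIndependent_dcov h ha hli hU)
    hH hsub

/-- The contrapositive: a common zero locus of entire functions that is not all of `ℂ^g` (a proper closed
subvariety of `A′`, pulled back) does not contain the image of any neighbourhood of a point of rank `g`. -/
theorem not_image_subset_zeroLocus_of_linearIndependent_dcov {p : ℕ}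
    (h : Fin g → (Fin p → ℂ) → ℂ) {z : Fin p → ℂ} (ha : ∀ l, AnalyticAt ℂ (h l) z)
    (hli : LinearIndependent ℂ fun l => dcov (h l) z) {U : Set (Fin p → ℂ)} (hU : U ∈ 𝓝 z)
    {ι : Type} {H : ι → (Fin g → ℂ) → ℂ} (hH : ∀ i, AnalyticOnNhd ℂ (H i) Set.univ)
    (hne : {w | ∀ i, H i w = 0} ≠ Set.univ) : ¬ ((fun w l => h l w) '' U ⊆ {w | ∀ i, H i w = 0}) :=
  fun hsub => hne (zeroLocus_eq_univ_of_image_subset_of_linearIndependent_dcov h ha hli hU hH hsub)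

end Dom

end HodgeRepro.BallGen

end
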